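import Summits.ResolutionOfSingularities.ResolutionOfSingularities.Theorems.ConeExit.Negative.Mirror
import HarnessLib

/-!
# Crux `ConeExit` (stmt-ResolutionOfSingularities-16883) — line `critical-plane`, lead's skeleton (reshaped)

Route `ResolutionOfSingularities/WildCones`, crux #3: the ONE-STEP CONE EXIT LEMMA. This is the
lead's reshaping of `Cruxes/ConeExit/Lines/critical_plane.lean` (planner-cstrat, 6 stubs): the same
composition idea (Case A / near direction / critical plane / plane criterion), but

* every stub is typed over the LANDED mirror of the crux's `let`-calculus
  (`Theorems/ConeExit/Negative/Mirror.lean`: `clean bl ord dv tr step ser pd jac cone Linv dL`,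
  `crux_iff : ConeExit ↔ … := Iff.rfl`), with `Isol / MultP / OrdP / planeMap` INLINED, so that every
  stub landed under `Theorems/` is importable verbatim by the closing file;
* the chart DICTIONARY is its own stub `stub_faceDictionary` (coefficients of `step p i τ c` on the
  face `{Bᵢ = 0}` = coefficients of the dehomogenised translated cone
  `P = a_p(w + v̂) = aeval (j ↦ if j = i then 1 else C (τ j) + X j) (cone p c)`), consumed three times;
* Case A is GLUE: `¬ OrdP ⇒ cone p c = 0 ⇒` the face coefficients of the successor vanish ⇒
  (`stub_faceToPlane` with `P = 0` on the coordinate plane `(e_j, e_j')`, `j ≠ j'` both `≠ i`, which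
  exist as `n ≥ 3`) the successor's Jacobian dies on that plane modulo the non-unit `∂ᵢ` ⇒
  (`stub_planeCriterion`) the successor is not isolated;
* the near direction and the plane Jacobian are PURE `MvPolynomial` identities
  (`stub_nearDirection'`, `stub_gradientOnPlane`) plus ONE series↔polynomial transfer
  (`stub_faceToPlane`);
* `stub_criticalPlane` (held by the lead) drops the idle `OrdP` / `PerfectField` hypotheses,
  `stub_planeCriterion` drops the idle `ĉᵢ = ℓᵢ = 0`.

Stubs (7): `stub_faceDictionary`, `stub_nearDirection'`, `stub_chern` (= support item
`ChernCriticalDirection`, verbatim), `stub_criticalPlane`, `stub_gradientOnPlane`, `stub_faceToPlane`,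
`stub_planeCriterion`. `ConeExit_of` takes exactly their statements (`Sig.*`) and is proved;
`ConeExit_proof` plugs the seven `stub_*` in.
-/

noncomputable section

-- single-problem summit: the doubled namespace component `ResolutionOfSingularities` is forced
set_option linter.dupNamespace false

open Summit.ResolutionOfSingularities.ResolutionOfSingularities.Theses.WildCones
  (ConeExit ChernCriticalDirection)
open Summit.ResolutionOfSingularities.ResolutionOfSingularities.Theorems.ConeExit.Negative
  (clean bl ord dv tr step ser pd jac cone Linv dL)
open scoped BigOperators

namespace Summit.ResolutionOfSingularities.ResolutionOfSingularities.Theorems.WildConesConeExit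

/-! ## The stub STATEMENTS by name (`Sig.stub_<name>`; `ConeExit_of` takes exactly these) -/

/-- Statement of `stub_faceDictionary` (THE CHART DICTIONARY): under multiplicity `p` of `c`, the
coefficient of the successor `step p i τ c` at an exponent `B` on the face `Bᵢ = 0` is the
(cleaned) coefficient of `X^B` in the dehomogenised translated cone
`a_p(w + v̂) = aeval (j ↦ if j = i then 1 else C (τ j) + X j) (cone p c)`. [folklore] -/
def Sig.stub_faceDictionary : Prop :=
  ∀ (p n : ℕ) (κ : Type) [Field κ] (c : (Fin n → ℕ) → κ) (i : Fin n) (τ : Fin n → κ) (B : Fin n → ℕ), ((∃ A, clean p c A ≠ 0) ∧ ∀ A, clean p c A ≠ 0 → p ≤ Finset.sum Finset.univ (fun j => A j)) → B i = 0 → step p i τ c B = if (∀ j, p ∣ B j) then 0 else MvPolynomial.coeff (Finsupp.equivFunOnFinite.symm B) (MvPolynomial.aeval (fun j : Fin n => if j = i then (1 : MvPolynomial (Fin n) κ) else MvPolynomial.C (τ j) + MvPolynomial.X j) (cone p c))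

/-- Statement of `stub_nearDirection'` (near points lie on `P(L)`, polynomial form): if the face
coefficients of `a_p(w + v̂)` vanish in degrees `1 … p-1`, then `w = update τ i 1 ∈ L(a_p)`.
[cite: Hironaka1970AdditiveGroups, Thm 2] -/
def Sig.stub_nearDirection' : Prop :=
  ∀ (p : ℕ), p.Prime → ∀ (n : ℕ) (κ : Type) [Field κ] [CharP κ p] (c : (Fin n → ℕ) → κ) (i : Fin n) (τ : Fin n → κ), (∀ B : Fin n →₀ ℕ, B i = 0 → B ≠ 0 → Finset.sum Finset.univ (fun j => B j) < p → MvPolynomial.coeff B (MvPolynomial.aeval (fun j : Fin n => if j = i then (1 : MvPolynomial (Fin n) κ) else MvPolynomial.C (τ j) + MvPolynomial.X j) (cone p c)) = 0) → Function.update τ i 1 ∈ Linv p c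

/-- Statement of `stub_chern` (= the route's support item `WildCones.ChernCriticalDirection`,
stmt-16885, verbatim). [cite: Jouanolou1979, Ch. 1] -/
def Sig.stub_chern : Prop :=
  ∀ p : ℕ, p.Prime → p ≠ 2 → ∀ (s : ℕ), 2 ≤ s → ∀ (k : Type) [Field k] [CharP k p] [IsAlgClosed k] (H : MvPolynomial (Fin s) k), H.IsHomogeneous p → H ≠ 0 → ∃ v : Fin s → k, v ≠ 0 ∧ ∀ j : Fin s, MvPolynomial.eval v (MvPolynomial.pderiv j H) = 0

/-- Statement of `stub_criticalPlane` (GIVEN the Chern lemma): `dL ≥ 2` and a direction `w ∈ L`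
with `wᵢ = 1` give, over `κ̄`, a critical direction `ĉ` of the cone and an `ℓ ∈ span L`, both with
`i`-th coordinate `0`, with a non-zero `2 × 2` minor. [cite: Jouanolou1979, Ch. 1] -/
def Sig.stub_criticalPlane : Prop :=
  ChernCriticalDirection → ∀ (p : ℕ), p.Prime → p ≠ 2 → ∀ (n : ℕ), 3 ≤ n → ∀ (κ : Type) [Field κ] [CharP κ p] (c : (Fin n → ℕ) → κ) (i : Fin n) (w : Fin n → κ), 2 ≤ dL p c → w ∈ Linv p c → w i = 1 → ∃ (ĉ ℓ : Fin n → AlgebraicClosure κ) (j j' : Fin n), (∀ k : Fin n, MvPolynomial.aeval ĉ (MvPolynomial.pderiv k (cone p c)) = 0) ∧ ℓ ∈ Submodule.span (AlgebraicClosure κ) ((fun (v : Fin n → κ) (k : Fin n) => algebraMap κ (AlgebraicClosure κ) (v k)) '' Linv p c) ∧ ĉ i = 0 ∧ ℓ i = 0 ∧ ĉ j * ℓ j' - ĉ j' * ℓ j ≠ 0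

/-- Statement of `stub_gradientOnPlane` (polynomial form of the plane Jacobian): along the plane of
a critical `ĉ` and an `ℓ ∈ span L` (both with `i`-th coordinate `0`) through the near point
`w = update τ i 1 ∈ L`, every `∂_k a_p(w + ·)`, `k ≠ i`, vanishes identically.
[cite: Hironaka1970AdditiveGroups, Thm 2] -/
def Sig.stub_gradientOnPlane : Prop :=
  ∀ (p : ℕ), p.Prime → ∀ (n : ℕ) (κ : Type) [Field κ] [CharP κ p] (c : (Fin n → ℕ) → κ) (i : Fin n) (τ : Fin n → κ) (K : Type) [Field K] [Algebra κ K] (ĉ ℓ : Fin n → K), Function.update τ i 1 ∈ Linv p c → (∀ k : Fin n, MvPolynomial.aeval ĉ (MvPolynomial.pderiv k (cone p c)) = 0) → ℓ ∈ Submodule.span K ((fun (v : Fin n → κ) (k : Fin n) => algebraMap κ K (v k)) '' Linv p c) → ĉ i = 0 → ℓ i = 0 → ∀ k : Fin n, k ≠ i → MvPolynomial.aeval (fun j : Fin n => MvPolynomial.C (ĉ j) * MvPolynomial.X (0 : Fin 2) + MvPolynomial.C (ℓ j) * MvPolynomial.X 1) (MvPolynomial.pderiv k (MvPolynomial.aeval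 (fun j : Fin n => if j = i then (1 : MvPolynomial (Fin n) κ) else MvPolynomial.C (τ j) + MvPolynomial.X j) (cone p c))) = 0

/-- Statement of `stub_faceToPlane` (series ↔ polynomial transfer): if the cleaned coefficients of
a state `c'` on the face `{Bᵢ = 0}` are the cleaned coefficients of a polynomial `P`, then along any
formal plane inside `{vᵢ = 0}` the image of `∂_k c'` (`k ≠ i`) is the polynomial `(∂_k P)` on the
plane, and the image of `∂ᵢ c'` has constant term `c'(eᵢ)`. [folklore] -/
def Sig.stub_faceToPlane : Prop :=
  ∀ (p : ℕ), p.Prime → ∀ (n : ℕ) (κ : Type) [Field κ] [CharP κ p] (c' : (Fin n → ℕ) → κ) (i : Fin n) (P : MvPolynomial (Fin n) κ) (K : Type) [Field K] [Algebra κ K] (ĉ ℓ : Fin n → K), ĉ i = 0 → ℓ i = 0 → (∀ B : Fin n → ℕ, B i = 0 → clean p c' B = if (∀ j, p ∣ B j) then 0 else MvPolynomial.coeff (Finsupp.equivFunOnFinite.symm B) P) → (∀ k : Fin n, k ≠ i → MvPowerSeries.subst (fun m : Fin n => MvPowerSeries.C (ĉ m) * MvPowerSeries.X (0 : Fin 2)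 + MvPowerSeries.C (ℓ m) * MvPowerSeries.X 1) (pd k (ser p c')) = ((MvPolynomial.aeval (fun m : Fin n => MvPolynomial.C (ĉ m) * MvPolynomial.X (0 : Fin 2) + MvPolynomial.C (ℓ m) * MvPolynomial.X 1) (MvPolynomial.pderiv k P) : MvPolynomial (Fin 2) K) : MvPowerSeries (Fin 2) K)) ∧ MvPowerSeries.constantCoeff (MvPowerSeries.subst (fun m : Fin n => MvPowerSeries.C (ĉ m) * MvPowerSeries.X (0 : Fin 2) + MvPowerSeries.C (ℓ m) * MvPowerSeries.X 1) (pd i (ser p c'))) = algebraMap κ K (clean p c' (Pi.single i 1))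

/-- Statement of `stub_planeCriterion` (PLANE CRITERION FOR NON-ISOLATEDNESS, any `p, n, κ`): if
the Jacobian ideal of a state dies, modulo one non-unit, on a non-degenerate formal 2-plane, the
state is not isolated. [cite: BoubakriGreuelMarkwig2010, §2] -/
def Sig.stub_planeCriterion : Prop :=
  ∀ (p n : ℕ) (κ : Type) [Field κ] (c' : (Fin n → ℕ) → κ) (i : Fin n) (K : Type) [Field K] [Algebra κ K] (ĉ ℓ : Fin n → K) (j j' : Fin n), ĉ j * ℓ j' - ĉ j' * ℓ j ≠ 0 → (∀ k : Fin n, k ≠ i → MvPowerSeries.subst (fun m : Fin n => MvPowerSeries.C (ĉ m) * MvPowerSeries.X (0 : Fin 2) + MvPowerSeries.C (ℓ m) * MvPowerSeries.X 1) (pd k (ser p c')) = 0) → MvPowerSeries.constantCoeff (MvPowerSeries.subst (fun m : Fin n => MvPowerSeries.C (ĉ m) * MvPowerSeries.X (0 : Fin 2) + MvPowerSeries.C (ℓ m) * MvPowerSeries.X 1) (pd i (ser p c'))) = 0 → ¬ Module.Finite κ (MvPowerSeries (Fin n) κ ⧸ jac p c')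

/-! ## The stubs -/

/-- **STUB (chart dictionary; size M+, bookkeeping).** [folklore] -/
theorem stub_faceDictionary : ∀ (p n : ℕ) (κ : Type) [Field κ] (c : (Fin n → ℕ) → κ) (i : Fin n) (τ : Fin n → κ) (B : Fin n → ℕ), ((∃ A, clean p c A ≠ 0) ∧ ∀ A, clean p c A ≠ 0 → p ≤ Finset.sum Finset.univ (fun j => A j)) → B i = 0 → step p i τ c B = if (∀ j, p ∣ B j) then 0 else MvPolynomial.coeff (Finsupp.equivFunOnFinite.symm B) (MvPolynomial.aeval (fun j : Fin n => if j = i then (1 : MvPolynomial (Fin n) κ) else MvPolynomial.C (τ j) + MvPolynomial.X j) (cone p c)) := by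
  sorry

/-- **STUB (near direction, polynomial form; size M).** [cite: Hironaka1970AdditiveGroups, Thm 2] -/
theorem stub_nearDirection' : ∀ (p : ℕ), p.Prime → ∀ (n : ℕ) (κ : Type) [Field κ] [CharP κ p] (c : (Fin n → ℕ) → κ) (i : Fin n) (τ : Fin n → κ), (∀ B : Fin n →₀ ℕ, B i = 0 → B ≠ 0 → Finset.sum Finset.univ (fun j => B j) < p → MvPolynomial.coeff B (MvPolynomial.aeval (fun j : Fin n => if j = i then (1 : MvPolynomial (Fin n) κ) else MvPolynomial.C (τ j) + MvPolynomial.X j) (cone p c)) = 0) → Function.update τ i 1 ∈ Linv p c := by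
  sorry

/-- **STUB (Chern / Euler–Koszul critical direction; = support item `ChernCriticalDirection`,
verbatim; size M).** [cite: Jouanolou1979, Ch. 1] -/
theorem stub_chern : ∀ p : ℕ, p.Prime → p ≠ 2 → ∀ (s : ℕ), 2 ≤ s → ∀ (k : Type) [Field k] [CharP k p] [IsAlgClosed k] (H : MvPolynomial (Fin s) k), H.IsHomogeneous p → H ≠ 0 → ∃ v : Fin s → k, v ≠ 0 ∧ ∀ j : Fin s, MvPolynomial.eval v (MvPolynomial.pderiv j H) = 0 := by
  sorry

/-- **STUB (critical plane; size M; held by the lead).** [cite: Jouanolou1979, Ch. 1] -/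
theorem stub_criticalPlane : ChernCriticalDirection → ∀ (p : ℕ), p.Prime → p ≠ 2 → ∀ (n : ℕ), 3 ≤ n → ∀ (κ : Type) [Field κ] [CharP κ p] (c : (Fin n → ℕ) → κ) (i : Fin n) (w : Fin n → κ), 2 ≤ dL p c → w ∈ Linv p c → w i = 1 → ∃ (ĉ ℓ : Fin n → AlgebraicClosure κ) (j j' : Fin n), (∀ k : Fin n, MvPolynomial.aeval ĉ (MvPolynomial.pderiv k (cone p c)) = 0) ∧ ℓ ∈ Submodule.span (AlgebraicClosure κ) ((fun (v : Fin n → κ) (k : Fin n) => algebraMap κ (AlgebraicClosure κ) (v k)) '' Linv p c) ∧ ĉ i = 0 ∧ ℓ i = 0 ∧ ĉ j * ℓ j' - ĉ j' * ℓ j ≠ 0 := by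
  sorry

/-- **STUB (gradient on the plane, polynomial form; size M+).** [cite: Hironaka1970AdditiveGroups, Thm 2] -/
theorem stub_gradientOnPlane : ∀ (p : ℕ), p.Prime → ∀ (n : ℕ) (κ : Type) [Field κ] [CharP κ p] (c : (Fin n → ℕ) → κ) (i : Fin n) (τ : Fin n → κ) (K : Type) [Field K] [Algebra κ K] (ĉ ℓ : Fin n → K), Function.update τ i 1 ∈ Linv p c → (∀ k : Fin n, MvPolynomial.aeval ĉ (MvPolynomial.pderiv k (cone p c)) = 0) → ℓ ∈ Submodule.span K ((fun (v : Fin n → κ) (k : Fin n) => algebraMap κ K (v k)) '' Linv p c) → ĉ i = 0 → ℓ i = 0 → ∀ k : Fin n, k ≠ i → MvPolynomial.aeval (fun j : Fin n => MvPolynomial.C (ĉ j) * MvPolynomial.X (0 : Fin 2) + MvPolynomial.C (ℓ j) * MvPolynomial.X 1) (MvPolynomial.pderiv k (MvPolynomial.aeval (fun j : Fin n => if j = i then (1 : MvPolynomial (Fin n) κ) else MvPolynomial.C (τ j) + MvPolynomial.X j) (cone p c))) = 0 := by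
  sorry

/-- **STUB (face-to-plane transfer; size M).** [folklore] -/
theorem stub_faceToPlane : ∀ (p : ℕ), p.Prime → ∀ (n : ℕ) (κ : Type) [Field κ] [CharP κ p] (c' : (Fin n → ℕ) → κ) (i : Fin n) (P : MvPolynomial (Fin n) κ) (K : Type) [Field K] [Algebra κ K] (ĉ ℓ : Fin n → K), ĉ i = 0 → ℓ i = 0 → (∀ B : Fin n → ℕ, B i = 0 → clean p c' B = if (∀ j, p ∣ B j) then 0 else MvPolynomial.coeff (Finsupp.equivFunOnFinite.symm B) P) → (∀ k : Fin n, k ≠ i → MvPowerSeries.subst (fun m : Fin n => MvPowerSeries.C (ĉ m) * MvPowerSeries.X (0 : Fin 2) + MvPowerSeries.C (ℓ m) * MvPowerSeries.X 1) (pd k (ser p c')) = ((MvPolynomial.aeval (fun m : Fin n => MvPolynomial.C (ĉ m) * MvPolynomial.X (0 : Fin 2) + MvPolynomial.C (ℓ m) * MvPolynomial.X 1) (MvPolynomial.pderiv k P) : MvPolynomial (Fin 2) K) : MvPowerSeries (Fin 2) K)) ∧ MvPowerSeries.constantCoeff (MvPowerSeries.subst (fun m : Fin n => MvPowerSeries.C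 (ĉ m) * MvPowerSeries.X (0 : Fin 2) + MvPowerSeries.C (ℓ m) * MvPowerSeries.X 1) (pd i (ser p c'))) = algebraMap κ K (clean p c' (Pi.single i 1)) := by
  sorry

/-- **STUB (plane criterion for non-isolatedness; size M; any `p, n, κ`).** [cite: BoubakriGreuelMarkwig2010, §2] -/
theorem stub_planeCriterion : ∀ (p n : ℕ) (κ : Type) [Field κ] (c' : (Fin n → ℕ) → κ) (i : Fin n) (K : Type) [Field K] [Algebra κ K] (ĉ ℓ : Fin n → K) (j j' : Fin n), ĉ j * ℓ j' - ĉ j' * ℓ j ≠ 0 → (∀ k : Fin n, k ≠ i → MvPowerSeries.subst (fun m : Fin n => MvPowerSeries.C (ĉ m) * MvPowerSeries.X (0 : Fin 2) + MvPowerSeries.C (ℓ m) * MvPowerSeries.X 1) (pd k (ser p c')) = 0) → MvPowerSeries.constantCoeff (MvPowerSeries.subst (fun m : Fin n => MvPowerSeries.C (ĉ m) * MvPowerSeries.X (0 : Fin 2) + MvPowerSeries.C (ℓ m) * MvPowerSeries.X 1) (pd i (ser p c'))) = 0 → ¬ Module.Finite κ (MvPowerSeries (Fin n) κ ⧸ jac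 p c') := by
  sorry

/-! ## Glue lemmas (proved) -/

section Glue

variable {n : ℕ} {κ : Type} [Field κ] (p : ℕ)

/-- Cleaning is idempotent. [folklore] -/
theorem clean_clean (c : (Fin n → ℕ) → κ) : clean p (clean p c) = clean p c := by
  funext A
  unfold clean
  by_cases h : ∀ j, p ∣ A j
  · rw [if_pos h, if_pos h]
  · rw [if_neg h, if_neg h]

/-- A step of the dynamics is already cleaned. [folklore] -/
theorem clean_step (i : Fin n) (τ : Fin n → κ) (c : (Fin n → ℕ) → κ) :
    clean p (step p i τ c) = step p i τ c := by
  unfold step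
  exact clean_clean p _

/-- Multiplicity `p ≥ 2` of a cleaned state kills its coefficient at `eᵢ` (degree `1 < p`).
[folklore] -/
theorem step_single_eq_zero (hp : p.Prime) (i : Fin n) (τ : Fin n → κ) (c : (Fin n → ℕ) → κ)
    (hM' : (∃ A, clean p (step p i τ c) A ≠ 0) ∧
      ∀ A, clean p (step p i τ c) A ≠ 0 → p ≤ Finset.sum Finset.univ (fun j => A j)) :
    step p i τ c (Pi.single i 1) = 0 := by
  by_contra h
  have h' : clean p (step p i τ c) (Pi.single i 1) ≠ 0 := by rwa [clean_step]
  have hle := hM'.2 _ h'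
  have hsum : Finset.sum Finset.univ (fun j => (Pi.single i 1 : Fin n → ℕ) j) = 1 := by
    rw [Finset.sum_pi_single']
    simp
  rw [hsum] at hle
  exact absurd hle (by have := hp.two_le; omega)

/-- If no cleaned coefficient of degree exactly `p` is non-zero, the cone vanishes. [folklore] -/
theorem cone_eq_zero_of_not_ordP (c : (Fin n → ℕ) → κ)
    (h : ¬ ∃ A, clean p c A ≠ 0 ∧ Finset.sum Finset.univ (fun j => A j) = p) :
    cone p c = 0 := by
  unfold cone
  refine Finset.sum_eq_zero (fun A _ => ?_)
  by_cases hA : Finset.sum Finset.univ (fun j => A j) = p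
  · rw [if_pos hA]
    have : clean p c A = 0 := by
      by_contra hne
      exact h ⟨A, hne, hA⟩
    rw [this, map_zero]
  · rw [if_neg hA]

/-- In `Fin n` with `n ≥ 3` there are two distinct indices both different from a given `i`.
[folklore] -/
theorem exists_pair_ne (hn : 3 ≤ n) (i : Fin n) : ∃ j j' : Fin n, j ≠ j' ∧ j ≠ i ∧ j' ≠ i := by
  have h0 : (0 : ℕ) < n := by omega
  have h1 : (1 : ℕ) < n := by omega
  have h2 : (2 : ℕ) < n := by omega
  by_cases hi0 : i = ⟨0, h0⟩
  · exact ⟨⟨1, h1⟩, ⟨2, h2⟩, by simp [Fin.ext_iff], by simp [hi0, Fin.ext_iff], by simp [hi0, Fin.ext_iff]⟩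
  · by_cases hi1 : i = ⟨1, h1⟩
    · exact ⟨⟨0, h0⟩, ⟨2, h2⟩, by simp [Fin.ext_iff], by simp [hi1, Fin.ext_iff], by simp [hi1, Fin.ext_iff]⟩
    · exact ⟨⟨0, h0⟩, ⟨1, h1⟩, by simp [Fin.ext_iff], Ne.symm hi0, Ne.symm hi1⟩

/-- If some non-zero `v` lies in the cone-invariance space then `1 ≤ dL`. [folklore] -/
theorem one_le_dL_of_mem {c : (Fin n → ℕ) → κ} {v : Fin n → κ} (hv : v ∈ Linv p c)
    (hv0 : v ≠ 0) : 1 ≤ dL p c := by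
  unfold dL
  calc 1 = Module.finrank κ (Submodule.span κ ({v} : Set (Fin n → κ))) :=
        (finrank_span_singleton hv0).symm
    _ ≤ Module.finrank κ (Submodule.span κ (Linv p c)) :=
        Submodule.finrank_mono (Submodule.span_mono (Set.singleton_subset_iff.mpr hv))

end Glue

/-! ## The compositions (kernel-checked; no `sorry` in their own terms) -/

/-- **Case A from the dictionary and the plane stubs**: multiplicity `p` at `c`, an ISOLATED
successor of multiplicity `p` ⇒ cleaned order EXACTLY `p`. If not, the cone vanishes, so by the
dictionary every face coefficient of the successor vanishes; on the coordinate plane `(e_j, e_j')`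
(`j ≠ j'`, both `≠ i`, by `n ≥ 3`) the transfer stub kills `∂_k` (`k ≠ i`) and gives `∂ᵢ` constant
term `c'(eᵢ) = 0`; the plane criterion contradicts isolatedness. PROVED. [folklore] -/
theorem caseA_of (h1 : Sig.stub_faceDictionary) (h6 : Sig.stub_faceToPlane)
    (h7 : Sig.stub_planeCriterion) :
    ∀ (p : ℕ), p.Prime → ∀ (n : ℕ), 3 ≤ n → ∀ (κ : Type) [Field κ] [CharP κ p]
      (c : (Fin n → ℕ) → κ) (i : Fin n) (τ : Fin n → κ),
      ((∃ A, clean p c A ≠ 0) ∧ ∀ A, clean p c A ≠ 0 → p ≤ Finset.sum Finset.univ (fun j => A j)) →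
      Module.Finite κ (MvPowerSeries (Fin n) κ ⧸ jac p (step p i τ c)) →
      ((∃ A, clean p (step p i τ c) A ≠ 0) ∧
        ∀ A, clean p (step p i τ c) A ≠ 0 → p ≤ Finset.sum Finset.univ (fun j => A j)) →
      ∃ A, clean p c A ≠ 0 ∧ Finset.sum Finset.univ (fun j => A j) = p := by
  intro p hp n hn κ _ _ c i τ hM hI' hM'
  by_contra hO
  have hcone : cone p c = 0 := cone_eq_zero_of_not_ordP p c hO
  -- face coefficients of the successor vanish (dictionary with cone = 0)
  have hface : ∀ B : Fin n → ℕ, B i = 0 → clean p (step p i τ c) B =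
      if (∀ j, p ∣ B j) then 0 else
        MvPolynomial.coeff (Finsupp.equivFunOnFinite.symm B) (0 : MvPolynomial (Fin n) κ) := by
    intro B hB
    rw [clean_step, h1 p n κ c i τ B hM hB, hcone, map_zero]
  obtain ⟨j, j', hjj', hji, hj'i⟩ := exists_pair_ne hn i
  -- the coordinate plane (e_j, e_j') inside {v_i = 0}
  let ĉ : Fin n → κ := fun m => if m = j then 1 else 0
  let ℓ : Fin n → κ := fun m => if m = j' then 1 else 0
  have hci : ĉ i = 0 := by simp [ĉ, Ne.symm hji]
  have hℓi : ℓ i = 0 := by simp [ℓ, Ne.symm hj'i]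
  have hdet : ĉ j * ℓ j' - ĉ j' * ℓ j ≠ 0 := by
    simp [ĉ, ℓ, hjj', Ne.symm hjj']
  obtain ⟨hvan, hconst⟩ := h6 p hp n κ (step p i τ c) i 0 κ ĉ ℓ hci hℓi hface
  have hvan0 : ∀ k : Fin n, k ≠ i →
      MvPowerSeries.subst (fun m : Fin n => MvPowerSeries.C (ĉ m) * MvPowerSeries.X (0 : Fin 2) +
        MvPowerSeries.C (ℓ m) * MvPowerSeries.X 1) (pd k (ser p (step p i τ c))) = 0 := by
    intro k hk
    rw [hvan k hk, map_zero, map_zero, MvPolynomial.coe_zero]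
  have hconst0 : MvPowerSeries.constantCoeff (MvPowerSeries.subst
      (fun m : Fin n => MvPowerSeries.C (ĉ m) * MvPowerSeries.X (0 : Fin 2) +
        MvPowerSeries.C (ℓ m) * MvPowerSeries.X 1) (pd i (ser p (step p i τ c)))) = 0 := by
    rw [hconst, clean_step, step_single_eq_zero p hp i τ c hM', map_zero]
  exact h7 p n κ (step p i τ c) i κ ĉ ℓ j j' hdet hvan0 hconst0 hI'

/-- **Near direction from the dictionary**: multiplicity `p` at `c` and a multiplicity-`p`
successor in chart `i` at translation `τ` force `update τ i 1 ∈ L(a_p)`. PROVED from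
`stub_faceDictionary` + `stub_nearDirection'`. [cite: Hironaka1970AdditiveGroups, Thm 2] -/
theorem nearDirection_of (h1 : Sig.stub_faceDictionary) (h2 : Sig.stub_nearDirection') :
    ∀ (p : ℕ), p.Prime → ∀ (n : ℕ) (κ : Type) [Field κ] [CharP κ p]
      (c : (Fin n → ℕ) → κ) (i : Fin n) (τ : Fin n → κ),
      ((∃ A, clean p c A ≠ 0) ∧ ∀ A, clean p c A ≠ 0 → p ≤ Finset.sum Finset.univ (fun j => A j)) →
      ((∃ A, clean p (step p i τ c) A ≠ 0) ∧
        ∀ A, clean p (step p i τ c) A ≠ 0 → p ≤ Finset.sum Finset.univ (fun j => A j)) →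
      Function.update τ i 1 ∈ Linv p c := by
  intro p hp n κ _ _ c i τ hM hM'
  refine h2 p hp n κ c i τ (fun B hBi hB0 hBp => ?_)
  have hnd : ¬ ∀ j, p ∣ (B : Fin n → ℕ) j := by
    intro hdiv
    apply hB0
    ext j
    have hj : B j ≤ Finset.sum Finset.univ (fun j => B j) :=
      Finset.single_le_sum (fun _ _ => Nat.zero_le _) (Finset.mem_univ j)
    have : B j < p := lt_of_le_of_lt hj hBp
    exact Nat.eq_zero_of_dvd_of_lt (hdiv j) this
  have hdict := h1 p n κ c i τ B hM hBi
  rw [if_neg hnd, Finsupp.equivFunOnFinite_symm_coe] at hdict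
  rw [← hdict]
  by_contra hne
  have h' : clean p (step p i τ c) B ≠ 0 := by rwa [clean_step]
  have := hM'.2 _ h'
  omega

/-- **Cone forcing from the plane stubs**: order `p`... precisely: multiplicity `p` at `c`, an
isolated multiplicity-`p` successor and `w = update τ i 1 ∈ L` force `dL ≤ 1`. If `dL ≥ 2`, the
critical plane exists (`stub_criticalPlane` fed with `stub_chern`), the gradient of the translated
cone dies on it (`stub_gradientOnPlane`), hence by the dictionary and the transfer stub the
successor's Jacobian dies on it modulo the non-unit `∂ᵢ`, and the plane criterion contradicts
isolatedness. PROVED. [folklore] -/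
theorem coneForcing_of (h1 : Sig.stub_faceDictionary) (h3 : Sig.stub_chern)
    (h4 : Sig.stub_criticalPlane) (h5 : Sig.stub_gradientOnPlane) (h6 : Sig.stub_faceToPlane)
    (h7 : Sig.stub_planeCriterion) :
    ∀ (p : ℕ), p.Prime → p ≠ 2 → ∀ (n : ℕ), 3 ≤ n → ∀ (κ : Type) [Field κ] [CharP κ p]
      (c : (Fin n → ℕ) → κ) (i : Fin n) (τ : Fin n → κ),
      ((∃ A, clean p c A ≠ 0) ∧ ∀ A, clean p c A ≠ 0 → p ≤ Finset.sum Finset.univ (fun j => A j)) →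
      Module.Finite κ (MvPowerSeries (Fin n) κ ⧸ jac p (step p i τ c)) →
      ((∃ A, clean p (step p i τ c) A ≠ 0) ∧
        ∀ A, clean p (step p i τ c) A ≠ 0 → p ≤ Finset.sum Finset.univ (fun j => A j)) →
      Function.update τ i 1 ∈ Linv p c → dL p c ≤ 1 := by
  intro p hp hp2 n hn κ _ _ c i τ hM hI' hM' hw
  by_contra hd
  have hd2 : 2 ≤ dL p c := by omega
  have hw1 : Function.update τ i (1 : κ) i = 1 := Function.update_self i 1 τ
  obtain ⟨ĉ, ℓ, j, j', hcrit, hℓ, hci, hℓi, hdet⟩ :=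
    h4 h3 p hp hp2 n hn κ c i (Function.update τ i 1) hd2 hw hw1
  have hgrad := h5 p hp n κ c i τ (AlgebraicClosure κ) ĉ ℓ hw hcrit hℓ hci hℓi
  have hface : ∀ B : Fin n → ℕ, B i = 0 → clean p (step p i τ c) B =
      if (∀ j, p ∣ B j) then 0 else MvPolynomial.coeff (Finsupp.equivFunOnFinite.symm B)
        (MvPolynomial.aeval (fun j : Fin n => if j = i then (1 : MvPolynomial (Fin n) κ) else
          MvPolynomial.C (τ j) + MvPolynomial.X j) (cone p c)) := by
    intro B hB
    rw [clean_step, h1 p n κ c i τ B hM hB]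
  obtain ⟨hvan, hconst⟩ := h6 p hp n κ (step p i τ c) i _ (AlgebraicClosure κ) ĉ ℓ hci hℓi hface
  have hvan0 : ∀ k : Fin n, k ≠ i →
      MvPowerSeries.subst (fun m : Fin n => MvPowerSeries.C (ĉ m) * MvPowerSeries.X (0 : Fin 2) +
        MvPowerSeries.C (ℓ m) * MvPowerSeries.X 1) (pd k (ser p (step p i τ c))) = 0 := by
    intro k hk
    rw [hvan k hk, hgrad k hk, MvPolynomial.coe_zero]
  have hconst0 : MvPowerSeries.constantCoeff (MvPowerSeries.subst
      (fun m : Fin n => MvPowerSeries.C (ĉ m) * MvPowerSeries.X (0 : Fin 2) +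
        MvPowerSeries.C (ℓ m) * MvPowerSeries.X 1) (pd i (ser p (step p i τ c)))) = 0 := by
    rw [hconst, clean_step, step_single_eq_zero p hp i τ c hM', map_zero]
  exact h7 p n κ (step p i τ c) i (AlgebraicClosure κ) ĉ ℓ j j' hdet hvan0 hconst0 hI'

/-- **`ConeExit` from the seven stub statements** — the assembly, PROVED. The route decl unfolds
to the mirrored calculus by `ζ/δ`-reduction (the `show`; cf. `Negative.crux_iff`), Case A gives
`OrdP`, the near direction `w = update τ i 1 ∈ L` with `w i = 1 ≠ 0` gives `1 ≤ dL`, cone forcing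
gives `dL ≤ 1`. [folklore] -/
theorem ConeExit_of :
    Sig.stub_faceDictionary → Sig.stub_nearDirection' → Sig.stub_chern → Sig.stub_criticalPlane →
      Sig.stub_gradientOnPlane → Sig.stub_faceToPlane → Sig.stub_planeCriterion → ConeExit := by
  intro h1 h2 h3 h4 h5 h6 h7 p hp hp2 n hn κ _ _ _ c i τ
  show Module.Finite κ (MvPowerSeries (Fin n) κ ⧸ jac p c) →
      ((∃ A, clean p c A ≠ 0) ∧ ∀ A, clean p c A ≠ 0 → p ≤ Finset.sum Finset.univ (fun j => A j)) →
      Module.Finite κ (MvPowerSeries (Fin n) κ ⧸ jac p (step p i τ c)) →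
      ((∃ A, clean p (step p i τ c) A ≠ 0) ∧
        ∀ A, clean p (step p i τ c) A ≠ 0 → p ≤ Finset.sum Finset.univ (fun j => A j)) →
      (∃ A, clean p c A ≠ 0 ∧ Finset.sum Finset.univ (fun j => A j) = p) ∧ dL p c = 1
  intro _ hM hI' hM'
  have hO := caseA_of h1 h6 h7 p hp n hn κ c i τ hM hI' hM'
  have hv : Function.update τ i 1 ∈ Linv p c := nearDirection_of h1 h2 p hp n κ c i τ hM hM'
  have hv0 : Function.update τ i (1 : κ) ≠ 0 := by
    intro h
    have h1 := congrFun h i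
    simp at h1
  exact ⟨hO, le_antisymm (coneForcing_of h1 h3 h4 h5 h6 h7 p hp hp2 n hn κ c i τ hM hI' hM' hv)
    (one_le_dL_of_mem p hv hv0)⟩

/-- **The crux `ConeExit`, assembled from the seven registered stubs** (the only `sorry`s in its
closure are the stubs). -/
theorem ConeExit_proof : ConeExit :=
  ConeExit_of stub_faceDictionary stub_nearDirection' stub_chern stub_criticalPlane
    stub_gradientOnPlane stub_faceToPlane stub_planeCriterion

end Summit.ResolutionOfSingularities.ResolutionOfSingularities.Theorems.WildConesConeExit

end
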